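/-
Copyright (c) 2026. All rights reserved.
Released under Apache 2.0 license as described in the file LICENSE.
Authors: abc-iut cell, prover seat abc-iut-w5-d144 (gen 6; row «COR510iv-SB′», brick E input «D2a-EMB», TS half), after abc-iut-w5-d053's
`plusToTS` lemmas (`LogFrobeniusObservablesTSOfPlus.lean`), for this seat's embeddings `embMonoPlus` / `embMonoTS` (p484312).
-/
import Literature.AnabelianGeometry.AbsoluteAnabelian.Ltimes.LogFrobeniusMonoTelecoreObservables
import Literature.AnabelianGeometry.AbsoluteAnabelian.StrictHomotopyFamilies
import Literature.AnabelianGeometry.AbsoluteAnabelian.DiagramPathEmbeddings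
import HarnessLib
import Literature.AnabelianGeometry.AbsoluteAnabelian.LogFrobeniusMonoTelecoreObservablesEmbTS

/-!
# [AbsTopIII] Cor 5.10 (iv)(b): the embedding of the `TS`-observable's diagram into the telecore diagram `D_{An⊢}` — bookkeeping

S. Mochizuki, *Topics in absolute anabelian geometry III*, J. Math. Sci. Univ. Tokyo 22 (2015) [MochizukiAbsTopIII2015];
manuscript `paper:url-5493eb38cbb7`: Cor 5.10 (iv)(b) pp. 147–148, Cor 5.5 (iii) p. 131, Def 3.5 (i) pp. 74–75.

PROOF-ONLY bookkeeping for abc-iut-f-101's brick D2 («sink at `𝒩⊞_v` = `Hplus v` transported along `embMonoPlus`;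
mapPath-injective + path lifting») about this seat's graph embeddings of p484312 (`embMonoPlus J v`, `embMonoTS J v`),
transposing abc-iut-w5-d053's `plusToTS_*` lemmas (`LogFrobeniusObservablesTSOfPlus.lean`): injectivity on objects /
arrows / paths; PATH LIFTING (`exists_eq_embMonoPlus_mapPath`, `exists_eq_embMonoTS_mapPath`: every path of `Γ⃗_{D_{An⊢}}`
INTO `𝒩⊞_v`, resp. `𝒩_v`, comes from the observable's graph — given `hJ`: telecore edges land at non-holomorphic vertices,
as the printed `φ^{An⊢⊞}_{w,ν} : An⊢ → 𝒩⊢⊞_w` do, `isEmpty_monoTelecoreIdx_of_isHolomorphic`); agreement of the path functors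
along the embeddings (`pathFunctor'_embMonoPlus_heq/_eq`, TS twins).  Nothing here bears on [IUTchIII] Cor. 3.12; no side taken.

**`⋉`-TWIN (cell row «LTIMES-SUCCESSOR», L4-lead m162; typing finding T3g9-F1).**  This file is the verbatim
re-elaboration of `LogFrobeniusMonoTelecoreObservablesEmbTS.lean` over the successor interface `LogFrobeniusSettingLtimes`
(`Ltimes/LogFrobeniusCompatibility.lean`: `ι⊞_{v,ε}` indexed by the edges of `Γ⃗^⋉_v` at EVERY place, [AbsTopIII] Cor 5.5 (iii)
p. 131), produced by the cell recipe `LTIMES-RECIPE.md`: names carry over inside `namespace LogFrobeniusSettingLtimes`, the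
section variable is `Lt`, setting-independent declarations are NOT repeated (the originals are in scope), statements and
proofs are otherwise unchanged.  The original file over the frozen interface stays as it is.
SLICE T9 (abc-iut-f-101 gen 6): the setting-free lemmas about the exported `embMonoTS` are exported; the path-functor / comap lemmas
are re-elaborated; one `erw` where the successor's `logDiagramTS` (built over this namespace's copy of `obsShape`) meets a path typed over
the exported frozen `logShapeTS` (equal up to unfolding only).
-/

universe u

open CategoryTheory Quiver

namespace Literature.AnabelianGeometry.AbsoluteAnabelian

namespace LogFrobeniusSettingLtimes

export LogFrobeniusSetting (embMonoTS_obj_injective embMonoTS_map_injective embMonoTS_mapPath_injective exists_eq_embMonoTS_mapPath graphEmbedding_embMonoTS isSieve_embMonoTS)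

variable {Vmod : Type u} {isArc : Vmod → Bool} (Lt : LogFrobeniusSettingLtimes Vmod isArc)
  (J : DSub (monoBase (Vmod := Vmod) (isArc := isArc) 6) → Type u) (v : Vmod)

/-! ## The `TS`-embedding `embMonoTS` -/

section TS

/-- A path of the `TS`-shape starting at the observation vertex `𝒩_v` ends there (no edge leaves `𝒩_v`).
[cite: MochizukiAbsTopIII2015, Definition 3.5 (iii) p.75] -/
private theorem eq_obs_of_path_from_obsTS' :
    ∀ {d : (logShapeTS (isArc := isArc) v).Vertex}, Path (logShapeTS (isArc := isArc) v).obs d →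
      d = (logShapeTS (isArc := isArc) v).obs := by
  intro d r
  induction r with
  | nil => rfl
  | cons r e ih =>
    rename_i b c
    subst ih
    cases c with
    | base _ => exact (PEmpty.elim e)
    | obs => exact (PEmpty.elim e)

variable (tel : ∀ {a : DSub (monoBase (Vmod := Vmod) (isArc := isArc) 6)}, J a → (Lt.AnMono ⥤ a.1.categoryLtimes Lt))

/-- The path functors of `D_{An⊢}` along a `TS`-embedded path are those of the `TS`-observable's diagram (structural variants).
[cite: MochizukiAbsTopIII2015, Definition 3.5 (i) pp.74–75] -/
theorem pathFunctor'_embMonoTS_heq {a : (logShapeTS (isArc := isArc) v).Vertex} :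
    ∀ {b : (logShapeTS (isArc := isArc) v).Vertex} (p : Path a b),
      HEq ((Lt.monoTelecoreDiagram J tel).pathFunctor' ((embMonoTS J v).mapPath p)) ((Lt.logDiagramTS v).pathFunctor' p)
  | _, Path.nil => by cases a <;> exact HEq.rfl
  | _, Path.cons (b := b) (c := c) p e => by
    have ih := pathFunctor'_embMonoTS_heq p
    rw [Prefunctor.mapPath_cons, DiagramOfCategories.pathFunctor'_cons]
    -- `erw`: the successor's `logDiagramTS` is built over the `⋉`-namespace copy of `obsShape`, the path over the
    -- exported frozen `logShapeTS` — equal up to unfolding, not syntactically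
    erw [DiagramOfCategories.pathFunctor'_cons]
    cases b with
    | obs => cases c <;> exact (PEmpty.elim e)
    | base y =>
      cases a with
      | obs => exact absurd (eq_obs_of_path_from_obsTS' v p) (fun h => by cases h)
      | base x =>
        cases c with
        | base z => rw [eq_of_heq ih]; rfl
        | obs => rw [eq_of_heq ih]; rfl

/-- For paths from a vertex of the portion into `𝒩_v`: an honest equation with the non-structural path functor of the
`TS`-observable's diagram. [cite: MochizukiAbsTopIII2015, Definition 3.5 (i) pp.74–75] -/
theorem pathFunctor'_embMonoTS_eq (x : DSub (InPortionThree (isArc := isArc) v))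
    (p : Path ((logShapeTS (isArc := isArc) v).base x) (logShapeTS (isArc := isArc) v).obs) :
    (Lt.monoTelecoreDiagram J tel).pathFunctor' ((embMonoTS J v).mapPath p) = (Lt.logDiagramTS v).pathFunctor p :=
  (eq_of_heq (Lt.pathFunctor'_embMonoTS_heq J v tel p)).trans ((Lt.logDiagramTS v).pathFunctor_eq_pathFunctor' p).symm

/-- The same with the non-structural path functor of `D_{An⊢}` on the left. [cite: MochizukiAbsTopIII2015, Definition 3.5 (i) pp.74–75] -/
theorem pathFunctor_embMonoTS_eq (x : DSub (InPortionThree (isArc := isArc) v))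
    (p : Path ((logShapeTS (isArc := isArc) v).base x) (logShapeTS (isArc := isArc) v).obs) :
    (Lt.monoTelecoreDiagram J tel).pathFunctor ((embMonoTS J v).mapPath p) = (Lt.logDiagramTS v).pathFunctor p :=
  ((Lt.monoTelecoreDiagram J tel).pathFunctor_eq_pathFunctor' _).trans (Lt.pathFunctor'_embMonoTS_eq J v tel x p)

end TS

/-! ## Appended (same seat, same evening): the observable's diagram IS `D_{An⊢}` pulled back along `embMonoTS` -/

section ComapAlongTS

variable (tel : ∀ {a : DSub (monoBase (Vmod := Vmod) (isArc := isArc) 6)}, J a → (Lt.AnMono ⥤ a.1.categoryLtimes Lt))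

/-- Vertex categories agree along `embMonoTS`. [cite: MochizukiAbsTopIII2015, Definition 3.5 (i) p.74] -/
theorem obj_logDiagramTS_eq_embMonoTS (a : (logShapeTS (isArc := isArc) v).Vertex) :
    (Lt.logDiagramTS v).obj a = (Lt.monoTelecoreDiagram J tel).obj ((embMonoTS J v).obj a) := by
  cases a <;> rfl

/-- … with the same category structures. [cite: MochizukiAbsTopIII2015, Definition 3.5 (i) p.74] -/
theorem cat_logDiagramTS_heq_embMonoTS (a : (logShapeTS (isArc := isArc) v).Vertex) :
    HEq ((Lt.logDiagramTS v).cat a) ((Lt.monoTelecoreDiagram J tel).cat ((embMonoTS J v).obj a)) := by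
  cases a <;> exact HEq.rfl

/-- Edge functors agree along `embMonoTS`. [cite: MochizukiAbsTopIII2015, Definition 3.5 (i) p.74] -/
theorem map_logDiagramTS_heq_embMonoTS {a b : (logShapeTS (isArc := isArc) v).Vertex} (e : a ⟶ b) :
    HEq ((Lt.logDiagramTS v).map e) ((Lt.monoTelecoreDiagram J tel).map ((embMonoTS J v).map e)) := by
  cases a with
  | base a =>
    cases b with
    | base b => exact HEq.rfl
    | obs => exact HEq.rfl
  | obs =>
    cases b with
    | base b => exact (PEmpty.elim e : False).elim
    | obs => exact (PEmpty.elim e : False).elim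

/-- ★ **The observable's diagram (observation vertex `𝒩_v`) IS the telecore diagram `D_{An⊢}` pulled back along `embMonoTS`**
(abc-iut-L4-t5's `comapAlong`, via `eq_comapAlong`): the form in which abc-iut-f-101's `DiagramPathEmbeddings` (`LiftPair`,
families on `F^*𝒟`) reads a family of homotopies of the observable inside `D_{An⊢}`.
[cite: MochizukiAbsTopIII2015, Definition 3.5 (i) p.74] -/
theorem logDiagramTS_eq_comapAlong_embMonoTS :
    Lt.logDiagramTS v = (Lt.monoTelecoreDiagram J tel).comapAlong (embMonoTS J v) :=
  DiagramOfCategories.eq_comapAlong (Lt.monoTelecoreDiagram J tel) (embMonoTS J v) (Lt.obj_logDiagramTS_eq_embMonoTS J v tel)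
    (Lt.cat_logDiagramTS_heq_embMonoTS J v tel) (fun e => Lt.map_logDiagramTS_heq_embMonoTS J v tel e)

end ComapAlongTS

end LogFrobeniusSettingLtimes

end Literature.AnabelianGeometry.AbsoluteAnabelian
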